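import Summits.QuantumFields.YangMills.Theorems.BalabanUVNodesN09MembershipDomainDoorAtRecord
import Literature.MathematicalPhysics.QuantumFieldTheory.Balaban1983to89.Node00.Record13NumericsOfThm1CCM

/-!
# NODE N09 — door v1.3 (F-I-χ «ρ-edition»): its LETTER rows are INHABITED AT THE Z3 PIN's REDUCED LETTERS with the door-local membership radius `ρ := a₀·L²∕(2·B₃)` — the kernel
# non-vacuity certificate for the letters (`0 < ρ ≤ ν.εreg ≤ εbg`, `2ρ ≤ ν.ε₀·L²`, the [B7]-numerics on `ρ`, and N07's window `2·B₃·ρ ≤ a₀·L²`) from the N09T3 engine's OWN rows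
# (`2·a₀ ≤ ε₀·L²`, the [B7]-numerics on `εbg = a₀`) and K0's guard `2·L² ≤ B₃`; director-ym №313 (R3) «kernel `two_radii_window_inhabited` shows the window INHABITED at the pin» — here per run

TRACK A (YM-PLAN §2d, node N09 of 28), seat `pub-ymgap-dag-n09-w1` (D-0149 width seat 1∕4), generation g8, file 7 of the (G-a) set (under the 12-file guard).  Key of record K1⁹
stmt-QuantumFields-27364 (`--supports … --as helper`, count-neutral).  [I] = [Balaban1987RG1], [B11] = [Balaban1985Variational], [B7] = [Balaban1985Averaging].  Imports the door at the record
(`…N09MembershipDomainDoorAtRecord`, for `numerics_ρ_of_le`) and DEF-1∕def-R's `Node00.Record13NumericsOfThm1CCM` (`numerics7OfThm1CCM`, faces `_εreg`∕`_ε₀` by `rfl`).  THEOREMS ONLY.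

WHY.  dag-n24-c's N09T3 engine (✓p726416) consumes N09's door at `ν := numerics7OfThm1CCM F.L j ε₀ B₃ B₃' a₀ a₁` (`ν.εreg = a₀`, `ν.ε₀ = ε₀`), `εbg := a₀`, with its own letter rows `ha₀ : 0 < a₀`,
K0's guard `2·(F.L)² ≤ B₃` (from `h1G3`), the LOCATED-K0ε₀ letter `2·a₀ ≤ ε₀·L²` (closed at its chosen `ε₀`) and the [B7]-numerics `hbg3`∕`hbg2` on `a₀`.  Door v1.3 displays instead the letters
`0 < ρ`, `ρ ≤ ν.εreg`, `ν.εreg ≤ εbg`, `2ρ ≤ ν.ε₀·L²` and the [B7]-numerics ON `ρ`, and N07's rows over `domU^ρ` are inside [B11] Thm 1's printed window iff `2·B₃·ρ ≤ a₀·L²` (memo §4 (c),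
✓p746046 §3).  THIS FILE shows, for every family `F` (`L ≥ 12`) and every run `P`, that the ONE choice `ρ := a₀·L²∕(2·B₃)` satisfies ALL of them from the engine's rows — so a regenerated
engine (under (D1′)) closes the door's letter rows with the terms below and `ρ` never becomes a new engine hypothesis; and ref-H's non-vacuity line for the letters has its witness.
* `rho_pos`, `rho_le_a₀`, `two_B₃_rho_le` (equality), `two_rho_le_eps0_Lsq` — pure arithmetic under `0 < a₀`, `2L² ≤ B₃`, `1 ≤ L`;
* ★★ `doorLetterRows_at_Z3_letters` — the conjunction, with `ν.εreg`∕`ν.ε₀` unfolded by `rfl` and the [B7] rows on `ρ` from the engine's rows on `a₀` (`numerics_ρ_of_le`).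
HONEST FRAMING: arithmetic on displayed letters + two `rfl` faces; nothing of Bałaban asserted; the rows `hopen`, `hχregU`, `hres`∕`huniq`, `haxDom`∕`haxbg`, `hint` of the door are NOT
touched (their «INHABITED BY» status is unchanged: not yet ∕ conventions); no engine regenerated (n24-c's, and only under (D1′)); FLAG №7′ OPEN; N09 ∕ N07 ∕ N24 NOT discharged; counts
unmoved (typed 28∕28 · discharged 8∕28); R4 = the conditional finite-𝕋⁴ rung `BalabanLadder.UV` only; the Yang–Mills mass gap (Clay) is NOT proved by any of this.
-/

noncomputable section

namespace Summit.QuantumFields.YangMills.BalabanUVNodes.N09MembershipDoorLettersAtZ3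

open Literature.MathematicalPhysics.QuantumFieldTheory.Balaban1983to89
open Literature.MathematicalPhysics.QuantumFieldTheory.Balaban1983to89.T4Continuum (T4Family)
open Literature.MathematicalPhysics.QuantumFieldTheory.Balaban1983to89.Node00
open Literature.MathematicalPhysics.QuantumFieldTheory.Balaban1983to89.ExpMeanLog (deltaSU)
open Summit.QuantumFields.YangMills.BalabanUVNodes.N09MembershipDomainDoorAtRecord (numerics_ρ_of_le)

/-! ## §1. Arithmetic of the door-local radius `ρ := a₀·L²∕(2·B₃)` under the engine's letters -/

/-- `0 < a₀·L²∕(2·B₃)` for `0 < a₀`, `1 ≤ L`, `2L² ≤ B₃`. [cite: Balaban1987RG1, (1.2) p.260 (bookkeeping)] -/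
theorem rho_pos {L B₃ a₀ : ℝ} (hL : 1 ≤ L) (hB : 2 * L ^ 2 ≤ B₃) (ha : 0 < a₀) : 0 < a₀ * L ^ 2 / (2 * B₃) := by
  have hL2 : 1 ≤ L ^ 2 := one_le_pow₀ hL
  have hB0 : 0 < B₃ := by nlinarith
  positivity

/-- `a₀·L²∕(2·B₃) ≤ a₀` for `0 < a₀`, `1 ≤ L`, `2L² ≤ B₃` (indeed `≤ a₀∕4`). [cite: Balaban1987RG1, (1.2) p.260 (bookkeeping)] -/
theorem rho_le_a₀ {L B₃ a₀ : ℝ} (hL : 1 ≤ L) (hB : 2 * L ^ 2 ≤ B₃) (ha : 0 < a₀) : a₀ * L ^ 2 / (2 * B₃) ≤ a₀ := by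
  have hL2 : 1 ≤ L ^ 2 := one_le_pow₀ hL
  have hB0 : 0 < B₃ := by nlinarith
  rw [div_le_iff₀ (by positivity)]
  nlinarith

/-- N07's window row at the door-local radius holds WITH EQUALITY: `2·B₃·(a₀·L²∕(2·B₃)) ≤ a₀·L²`. [cite: Balaban1985Variational, Thm 1 p.279; Balaban1987RG1, (2.2)–(2.3) p.265 (bookkeeping)] -/
theorem two_B₃_rho_le {L B₃ a₀ : ℝ} (hL : 1 ≤ L) (hB : 2 * L ^ 2 ≤ B₃) : 2 * B₃ * (a₀ * L ^ 2 / (2 * B₃)) ≤ a₀ * L ^ 2 := by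
  have hL2 : 1 ≤ L ^ 2 := one_le_pow₀ hL
  have hB0 : 0 < B₃ := by nlinarith
  have h : 2 * B₃ * (a₀ * L ^ 2 / (2 * B₃)) = a₀ * L ^ 2 := by field_simp
  exact h.le

/-- The nesting letter at the door-local radius from the engine's LOCATED-K0ε₀ letter: `2·a₀ ≤ ε₀·L′²` ⇒ `2·(a₀·L²∕(2·B₃)) ≤ ε₀·L′²` (any `L′`; `2ρ ≤ a₀ ≤ 2a₀`).
[cite: Balaban1987RG1, (1.2) p.260 and p.259 (bookkeeping)] -/
theorem two_rho_le_eps0_Lsq {L L' B₃ a₀ ε₀ : ℝ} (hL : 1 ≤ L) (hB : 2 * L ^ 2 ≤ B₃) (ha : 0 < a₀) (hbg₀ : 2 * a₀ ≤ ε₀ * L' ^ 2) :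
    2 * (a₀ * L ^ 2 / (2 * B₃)) ≤ ε₀ * L' ^ 2 := by
  have h := rho_le_a₀ hL hB ha
  linarith

/-! ## §2. The door's letter rows at the Z3 pin's reduced letters -/

/-- ★★ **THE DOOR's LETTER ROWS ARE INHABITED AT THE Z3 PIN WITH `ρ := a₀·L²∕(2·B₃)`**: at `ν := numerics7OfThm1CCM F.L j ε₀ B₃ B₃' a₀ a₁` (`ν.εreg = a₀`, `ν.ε₀ = ε₀`, both `rfl`) and
`εbg := a₀`, given the engine's letters `0 < a₀`, K0's guard `2·(F.L)² ≤ B₃`, the LOCATED-K0ε₀ row `2·a₀ ≤ ε₀·(F.P P.K).L²` and the [B7]-numerics on `a₀` per run, the door's rows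
`0 < ρ`, `ρ ≤ ν.εreg`, `ν.εreg ≤ εbg`, `2ρ ≤ ν.ε₀·(F.P P.K).L²`, the two [B7]-numerics on `ρ`, AND N07's window `2·B₃·ρ ≤ a₀·(F.L)²` all hold.  Letters only; nothing of Bałaban asserted.
[cite: Balaban1987RG1, (1.2) p.260, p.259 and (2.2)–(2.3) p.265; Balaban1985Variational, Thm 1 p.279; Balaban1985Averaging, Prop. 2 (53) p.26 (bookkeeping)] -/
theorem doorLetterRows_at_Z3_letters (F : T4Family) (N : ℕ) (j : ℕ) (ε₀ B₃ B₃' a₀ a₁ : ℝ) (ha₀ : 0 < a₀) (hB₃ : 2 * (F.L : ℝ) ^ 2 ≤ B₃)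
    (hbg₀ : ∀ P : B12.RunParams, 2 * a₀ ≤ ε₀ * ((F.P P.K).L : ℝ) ^ 2)
    (hbg3 : ∀ P : B12.RunParams, (143 * (((((F.P P.K).d + 4 : ℕ) : ℝ)) ^ 2 / 4) ^ 2) * a₀ ≤ 1 / 3)
    (hbg2 : ∀ P : B12.RunParams, 2 * a₀ ≤ 2 * deltaSU (Fin N) / ((((F.P P.K).d + 4) * (F.P P.K).L : ℕ) : ℝ) ^ 2) :
    0 < a₀ * (F.L : ℝ) ^ 2 / (2 * B₃) ∧
    a₀ * (F.L : ℝ) ^ 2 / (2 * B₃) ≤ (numerics7OfThm1CCM F.L j ε₀ B₃ B₃' a₀ a₁).εreg ∧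
    (numerics7OfThm1CCM F.L j ε₀ B₃ B₃' a₀ a₁).εreg ≤ a₀ ∧
    2 * B₃ * (a₀ * (F.L : ℝ) ^ 2 / (2 * B₃)) ≤ a₀ * (F.L : ℝ) ^ 2 ∧
    (∀ P : B12.RunParams, 2 * (a₀ * (F.L : ℝ) ^ 2 / (2 * B₃)) ≤ (numerics7OfThm1CCM F.L j ε₀ B₃ B₃' a₀ a₁).ε₀ * ((F.P P.K).L : ℝ) ^ 2) ∧
    (∀ P : B12.RunParams,
      (143 * (((((F.P P.K).d + 4 : ℕ) : ℝ)) ^ 2 / 4) ^ 2) * (a₀ * (F.L : ℝ) ^ 2 / (2 * B₃)) ≤ 1 / 3 ∧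
      2 * (a₀ * (F.L : ℝ) ^ 2 / (2 * B₃)) ≤ 2 * deltaSU (Fin N) / ((((F.P P.K).d + 4) * (F.P P.K).L : ℕ) : ℝ) ^ 2) := by
  have hL : (1 : ℝ) ≤ F.L := by exact_mod_cast F.hL.2.le
  refine ⟨rho_pos hL hB₃ ha₀, ?_, ?_, two_B₃_rho_le hL hB₃, fun P => ?_, fun P => ?_⟩
  · rw [numerics7OfThm1CCM_εreg]; exact rho_le_a₀ hL hB₃ ha₀
  · rw [numerics7OfThm1CCM_εreg]
  · rw [numerics7OfThm1CCM_ε₀]; exact two_rho_le_eps0_Lsq hL hB₃ ha₀ (hbg₀ P)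
  · exact numerics_ρ_of_le (rho_le_a₀ hL hB₃ ha₀) (hbg3 P) (hbg2 P)

end Summit.QuantumFields.YangMills.BalabanUVNodes.N09MembershipDoorLettersAtZ3

end
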